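import Literature.NumberTheory.Transcendental.BakerLogarithmsConclusion
import Summits.KontsevichZagierPeriods.KontsevichZagierPeriods.Theorems.GammaHodgeSector.Negative.Algebraicity

/-!
# Constant-coefficient rigidity
(stub `stub_constRigidity`, line `logderiv-peeling`, crux `LogPrimitiveNL`,
stmt-KontsevichZagierPeriods-2836)

Bottom of the Kolchin–Ostrowski descent of the line `logderiv-peeling` for the crux
`LiouvilleUnfolding.LogPrimitiveNL`: an identity `Σᵢ cᵢ log Wᵢ = G` on an OPEN `D ⊆ ℝⁿ` with
ALGEBRAIC constants `cᵢ`, continuous positive `ℚ`-semialgebraic `Wᵢ` and continuous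
`ℚ`-semialgebraic `G` forces `G ≡ 0` on `D` and `c = Σ_r β_r f_r` with `β_r` algebraic and
integer vectors `f_r` that are exact multiplicative relations `∏ᵢ Wᵢ ^ (f_r i) ≡ 1` on `D`.

Proof.
* Baker (`baker_holds`, Baker 1975 Thm. 2.1) at a maximal `ℚ`-free subfamily of the logarithms
  kills every coefficient of the expanded relation, the constant one included
  (`constRig_baker_complex`); two real corollaries: for positive real algebraic `α` and real
  algebraic `β₀, β`, `Σ βⱼ log αⱼ = β₀` forces `β₀ = 0` (`constRig_baker_real_eq_zero`), and if
  moreover the `βⱼ` are `ℚ`-linearly independent then every `αⱼ = 1`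
  (`constRig_baker_real_eq_one_of_linearIndependent`).
* Integer structure of the coefficient vector (`constRig_exists_int_structure`): a maximal
  `ℚ`-free subfamily of `c` (`exists_linearIndependent'`), rational coordinates, one common
  denominator.
* At a RATIONAL point of `D` all the `Wᵢ`, `G` take algebraic values
  (`GammaHodgeSectorNegative.isAlgebraic_apply_ratCast`, re-exported in `∀`-form as the registered
  auxiliary stub `constRig_isAlgebraic_apply_ratCast`), so the two corollaries apply after
  regrouping `Σᵢ cᵢ log wᵢ = Σ_r β_r log ∏ᵢ wᵢ ^ (f_r i)`; rational points are dense in the open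
  `D` (`constRig_exists_ratCast_mem_of_isOpen`) and both conclusions are closed conditions in `x`
  (`constRig_eqOn_const_of_ratCast`).

The hypothesis `IsSemialgebraic ℚ D` of the registered signature is not used.
-/

noncomputable section

open Set MeasureTheory
open Literature.NumberTheory.Transcendental Literature.ModelTheory.ExponentialFields

namespace Summit.KontsevichZagierPeriods.LiouvilleUnfolding.LogPrimitiveNL

/-! ## Baker's theorem: the corollaries used -/

section Baker

/-- **Baker at a maximal `ℚ`-free subfamily** (from `baker_holds`, Baker 1975 Thm. 2.1): if
`Σ βᵢ lᵢ = β₀` with `e^{lᵢ}`, `βᵢ`, `β₀` algebraic, then `β₀ = 0`, and if moreover the `βᵢ` are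
linearly independent over `ℚ` then every `lᵢ = 0`. Proof: expand the `lᵢ` rationally in a
maximal `ℚ`-independent subfamily `l ∘ a` (`exists_linearIndependent'`); Baker makes
`1, (l ∘ a)` linearly independent over `ℚ̄`, so every `ℚ̄`-coefficient of the expanded relation
`-β₀ · 1 + Σₛ (Σᵢ βᵢ qᵢₛ) · l (a s) = 0` vanishes: `β₀ = 0` (the inhomogeneous corollary, landed
on its own as `Negative.baker_sum_eq_zero` in `Theorems/LogPrimitiveNL/Negative/DimZero.lean`)
and `Σᵢ βᵢ qᵢₛ = 0`, where `ℚ`-independence of `β` kills every rational coordinate `qᵢₛ`.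
[folklore] -/
theorem constRig_baker_complex {k : ℕ} (l β : Fin k → ℂ) (β₀ : ℂ)
    (halg : ∀ i, IsAlgebraic ℚ (Complex.exp (l i))) (hβ : ∀ i, IsAlgebraic ℚ (β i))
    (hβ₀ : IsAlgebraic ℚ β₀) (hsum : ∑ i, β i * l i = β₀) :
    β₀ = 0 ∧ (LinearIndependent ℚ β → ∀ i, l i = 0) := by
  classical
  set K := algebraicClosure ℚ ℂ
  obtain ⟨κ, a, ha, hspan, hla⟩ := exists_linearIndependent' (K := ℚ) l
  haveI : Finite κ := Finite.of_injective a ha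
  letI : Fintype κ := Fintype.ofFinite κ
  -- Baker: `1, l ∘ a` are linearly independent over `K`
  have hB := baker_holds (l ∘ a) (fun s => halg (a s)) hla
  -- expand each `l i` in the `ℚ`-span of `l ∘ a`
  have hmem : ∀ i, l i ∈ Submodule.span ℚ (Set.range (l ∘ a)) := fun i => by
    rw [hspan]
    exact Submodule.subset_span ⟨i, rfl⟩
  choose q hq using fun i => (Submodule.mem_span_range_iff_exists_fun ℚ).1 (hmem i)
  have hβK : ∀ i, β i ∈ K := fun i => mem_algebraicClosure_iff.mpr (hβ i)
  have hβ₀K : β₀ ∈ K := mem_algebraicClosure_iff.mpr hβ₀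
  have hqK : ∀ i s, ((q i s : ℚ) : ℂ) ∈ K := fun i s => by
    rw [← eq_ratCast (algebraMap ℚ ℂ)]
    exact K.algebraMap_mem (q i s)
  have hzK : ∀ s, (∑ i, β i * (q i s : ℂ)) ∈ K := fun s =>
    sum_mem fun i _ => mul_mem (hβK i) (hqK i s)
  -- the expanded relation
  have hexp : ∑ s, (∑ i, β i * (q i s : ℂ)) * l (a s) = β₀ := by
    calc ∑ s, (∑ i, β i * (q i s : ℂ)) * l (a s)
          = ∑ i, β i * ∑ s, (q i s : ℂ) * l (a s) := by
          simp_rw [Finset.sum_mul, Finset.mul_sum]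
          rw [Finset.sum_comm]
          simp_rw [mul_assoc]
      _ = ∑ i, β i * l i := by
          refine Finset.sum_congr rfl fun i _ => ?_
          rw [← hq i]
          simp_rw [Rat.smul_def, Function.comp_apply]
      _ = β₀ := hsum
  -- its coefficients, as elements of `K`, indexed like Baker's family `1, l ∘ a`
  let g : Option κ → K := fun o =>
    o.elim ⟨-β₀, neg_mem hβ₀K⟩ fun s => ⟨∑ i, β i * (q i s : ℂ), hzK s⟩
  have hg : ∑ o, g o • (o.elim (1 : ℂ) (l ∘ a)) = 0 := by
    have h0 : g none • ((none : Option κ).elim (1 : ℂ) (l ∘ a)) = -β₀ := by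
      rw [IntermediateField.smul_def]
      change (-β₀) • (1 : ℂ) = -β₀
      rw [smul_eq_mul, mul_one]
    have h1 : ∀ s, g (some s) • ((some s).elim (1 : ℂ) (l ∘ a)) =
        (∑ i, β i * (q i s : ℂ)) * l (a s) := fun s => by
      rw [IntermediateField.smul_def]
      rfl
    rw [Fintype.sum_option, h0, Finset.sum_congr rfl fun s _ => h1 s, hexp, neg_add_cancel]
  have hg0 : ∀ o, g o = 0 := Fintype.linearIndependent_iff.mp hB g hg
  have h₀ : β₀ = 0 := by
    have := congrArg (fun x : K => (x : ℂ)) (hg0 none)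
    simpa [g] using this
  refine ⟨h₀, fun hli i => ?_⟩
  have hq0 : ∀ j s, q j s = 0 := by
    intro j s
    have h1 : ∑ j, β j * (q j s : ℂ) = 0 := by
      have := congrArg (fun x : K => (x : ℂ)) (hg0 (some s))
      simpa [g] using this
    have h2 : ∑ j, q j s • β j = 0 := by
      rw [← h1]
      exact Finset.sum_congr rfl fun j _ => by rw [Rat.smul_def, mul_comm]
    exact Fintype.linearIndependent_iff.mp hli (fun j => q j s) h2 j
  rw [← hq i]
  exact Finset.sum_eq_zero fun s _ => by simp [hq0]

/-- **Real Baker, inhomogeneous**: for positive real algebraic `wᵢ`, real algebraic `cᵢ` and a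
real algebraic value `G₀ = Σ cᵢ log wᵢ`, necessarily `G₀ = 0` (complexify: `e^{log wᵢ} = wᵢ`).
[folklore] -/
theorem constRig_baker_real_eq_zero {k : ℕ} (w c : Fin k → ℝ) (G₀ : ℝ) (hw : ∀ i, 0 < w i)
    (hwalg : ∀ i, IsAlgebraic ℚ (w i)) (hc : ∀ i, IsAlgebraic ℚ (c i))
    (hG : IsAlgebraic ℚ G₀) (hsum : ∑ i, c i * Real.log (w i) = G₀) : G₀ = 0 := by
  have halg : ∀ i, IsAlgebraic ℚ (Complex.exp ((Real.log (w i) : ℝ) : ℂ)) := fun i => by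
    rw [← Complex.ofReal_exp, Real.exp_log (hw i)]
    exact (hwalg i).algebraMap
  have hsumC : ∑ i, ((c i : ℝ) : ℂ) * ((Real.log (w i) : ℝ) : ℂ) = ((G₀ : ℝ) : ℂ) := by
    rw [← hsum]
    push_cast
    rfl
  have h0 := (constRig_baker_complex (fun i => ((Real.log (w i) : ℝ) : ℂ))
    (fun i => ((c i : ℝ) : ℂ)) ((G₀ : ℝ) : ℂ) halg (fun i => (hc i).algebraMap) hG.algebraMap
    hsumC).1
  exact_mod_cast h0

/-- **Real Baker, homogeneous with `ℚ`-free coefficients**: for positive real algebraic `uᵣ` and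
real algebraic `βᵣ` linearly independent over `ℚ`, `Σ βᵣ log uᵣ = 0` forces every `uᵣ = 1`.
[folklore] -/
theorem constRig_baker_real_eq_one_of_linearIndependent {R : ℕ} (u β : Fin R → ℝ)
    (hu : ∀ r, 0 < u r) (hualg : ∀ r, IsAlgebraic ℚ (u r)) (hβ : ∀ r, IsAlgebraic ℚ (β r))
    (hli : LinearIndependent ℚ β) (hsum : ∑ r, β r * Real.log (u r) = 0) : ∀ r, u r = 1 := by
  have halg : ∀ r, IsAlgebraic ℚ (Complex.exp ((Real.log (u r) : ℝ) : ℂ)) := fun r => by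
    rw [← Complex.ofReal_exp, Real.exp_log (hu r)]
    exact (hualg r).algebraMap
  have hliC : LinearIndependent ℚ (fun r => ((β r : ℝ) : ℂ)) := by
    rw [Fintype.linearIndependent_iff] at hli ⊢
    intro g hg r
    refine hli g ?_ r
    have hj : ∀ j, ((g j • β j : ℝ) : ℂ) = g j • ((β j : ℝ) : ℂ) := fun j => by
      simp only [Rat.smul_def, Complex.ofReal_mul, Complex.ofReal_ratCast]
    apply Complex.ofReal_injective
    rw [Complex.ofReal_zero, ← hg, Complex.ofReal_sum]
    exact Finset.sum_congr rfl fun j _ => hj j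
  have hsumC : ∑ r, ((β r : ℝ) : ℂ) * ((Real.log (u r) : ℝ) : ℂ) = 0 := by
    have := congrArg (fun t : ℝ => (t : ℂ)) hsum
    push_cast at this
    exact this
  have h0 := (constRig_baker_complex (fun r => ((Real.log (u r) : ℝ) : ℂ))
    (fun r => ((β r : ℝ) : ℂ)) 0 halg (fun r => (hβ r).algebraMap) isAlgebraic_zero hsumC).2 hliC
  intro r
  have : Real.log (u r) = 0 := by exact_mod_cast h0 r
  exact Real.eq_one_of_pos_of_log_eq_zero (hu r) this

end Baker

/-! ## Values of `ℚ`-semialgebraic functions at rational points -/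

/-- **Semialgebraic functions take algebraic values at rational points** — the registered
auxiliary stub `constRig_isAlgebraic_apply_ratCast` of the crux, in `∀`-form; it IS the landed
theorem `GammaHodgeSectorNegative.isAlgebraic_apply_ratCast`
(`Theorems/GammaHodgeSector/Negative/Algebraicity.lean`: slice the graph at the rational point,
then a `ℚ`-semialgebraic point of `ℝ¹` is a root of a non-zero rational polynomial). [folklore] -/
theorem constRig_isAlgebraic_apply_ratCast :
    ∀ (m : ℕ) (s : Set (Fin m → ℝ)) (f : (Fin m → ℝ) → ℝ) (z : Fin m → ℚ),
      IsSemialgebraicFunOn ℚ s f → (fun i => (z i : ℝ)) ∈ s →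
      IsAlgebraic ℚ (f fun i => (z i : ℝ)) :=
  fun _ _ _ z hf hz => GammaHodgeSectorNegative.isAlgebraic_apply_ratCast hf z hz

/-! ## Integer structure of an algebraic coefficient vector -/

/-- **`ℚ`-free integer structure of a finite family of algebraic reals**: there are `ℚ`-linearly
independent algebraic reals `β₁, …, β_R` and an integer matrix `f` with `cᵢ = Σ_r β_r f_r i`
(maximal `ℚ`-independent subfamily `c ∘ a` of `c`, rational coordinates `m`, common denominator
`N`: `β_r = c (a r) / N`, `f_r i = N · mᵢᵣ`). [folklore] -/
theorem constRig_exists_int_structure {k : ℕ} (c : Fin k → ℝ) (hc : ∀ i, IsAlgebraic ℚ (c i)) :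
    ∃ (R : ℕ) (f : Fin R → Fin k → ℤ) (β : Fin R → ℝ), (∀ r, IsAlgebraic ℚ (β r)) ∧
      LinearIndependent ℚ β ∧ (∀ i, c i = ∑ r, β r * (f r i : ℝ)) := by
  classical
  obtain ⟨κ, a, ha, hspan, hla⟩ := exists_linearIndependent' (K := ℚ) c
  haveI : Finite κ := Finite.of_injective a ha
  letI : Fintype κ := Fintype.ofFinite κ
  set R := Fintype.card κ
  let e : κ ≃ Fin R := Fintype.equivFin κ
  have hmem : ∀ i, c i ∈ Submodule.span ℚ (Set.range (c ∘ a)) := fun i => by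
    rw [hspan]
    exact Submodule.subset_span ⟨i, rfl⟩
  choose m hm using fun i => (Submodule.mem_span_range_iff_exists_fun ℚ).1 (hmem i)
  -- common denominator
  let N : ℕ := ∏ i, ∏ s, (m i s).den
  have hNpos : 0 < N :=
    Finset.prod_pos fun i _ => Finset.prod_pos fun s _ => (m i s).den_pos
  have hN : (N : ℝ) ≠ 0 := by exact_mod_cast hNpos.ne'
  have hdvd : ∀ i s, (m i s).den ∣ N := fun i s =>
    (Finset.dvd_prod_of_mem (fun s => (m i s).den) (Finset.mem_univ s)).trans
      (Finset.dvd_prod_of_mem (fun i => ∏ s, (m i s).den) (Finset.mem_univ i))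
  -- the integer matrix and the coefficients
  let f : Fin R → Fin k → ℤ := fun r i =>
    (m i (e.symm r)).num * ((N / (m i (e.symm r)).den : ℕ) : ℤ)
  have hf : ∀ r i, (f r i : ℝ) = (m i (e.symm r) : ℝ) * N := by
    intro r i
    set q := m i (e.symm r) with hq
    have h1 : ((q.den * (N / q.den) : ℕ) : ℝ) = N := by rw [Nat.mul_div_cancel' (hdvd _ _)]
    have h2 : (q : ℝ) * q.den = q.num := by exact_mod_cast Rat.mul_den_eq_num q
    calc (f r i : ℝ) = (q.num : ℝ) * ((N / q.den : ℕ) : ℝ) := by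
          simp only [f, ← hq, Int.cast_mul, Int.cast_natCast]
      _ = (q : ℝ) * q.den * ((N / q.den : ℕ) : ℝ) := by rw [h2]
      _ = q * N := by rw [mul_assoc, ← Nat.cast_mul, h1]
  let β : Fin R → ℝ := fun r => c (a (e.symm r)) / N
  refine ⟨R, f, β, fun r => ?_, ?_, fun i => ?_⟩
  · -- algebraic
    rw [← mem_algebraicClosure_iff]
    exact div_mem (mem_algebraicClosure_iff.mpr (hc _)) (natCast_mem _ N)
  · -- `ℚ`-linearly independent
    have hla' : LinearIndependent ℚ ((c ∘ a) ∘ e.symm) := hla.comp e.symm e.symm.injective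
    rw [Fintype.linearIndependent_iff] at hla' ⊢
    intro g hg r
    refine hla' g ?_ r
    have : ∑ r, g r • ((c ∘ a) ∘ e.symm) r = (∑ r, g r • β r) * N := by
      rw [Finset.sum_mul]
      refine Finset.sum_congr rfl fun r _ => ?_
      simp only [β, Function.comp_apply, Rat.smul_def]
      field_simp
    rw [this, hg, zero_mul]
  · -- the expansion
    calc c i = ∑ s, m i s • (c ∘ a) s := (hm i).symm
      _ = ∑ r, m i (e.symm r) • (c ∘ a) (e.symm r) :=
          (Fintype.sum_equiv e.symm (fun r => m i (e.symm r) • (c ∘ a) (e.symm r))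
            (fun s => m i s • (c ∘ a) s) fun r => rfl).symm
      _ = ∑ r, β r * (f r i : ℝ) := Finset.sum_congr rfl fun r _ => by
          rw [hf r i, Rat.smul_def]
          simp only [β, Function.comp_apply]
          field_simp

/-! ## Rational points of open sets -/

/-- Every nonempty open subset of `ℝⁿ` contains a point with rational coordinates
(`ℚⁿ` is dense: `dense_pi` and `Rat.denseRange_cast`). [folklore] -/
theorem constRig_exists_ratCast_mem_of_isOpen {n : ℕ} {U : Set (Fin n → ℝ)} (hU : IsOpen U)
    (hne : U.Nonempty) : ∃ z : Fin n → ℚ, (fun i => (z i : ℝ)) ∈ U := by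
  have hd : Dense (Set.pi Set.univ fun _ : Fin n => Set.range ((↑) : ℚ → ℝ)) :=
    dense_pi Set.univ fun _ _ => Rat.denseRange_cast
  obtain ⟨y, hyU, hy⟩ := hd.inter_open_nonempty U hU hne
  simp only [Set.mem_pi, Set.mem_univ, true_implies, Set.mem_range] at hy
  choose z hz using hy
  refine ⟨z, ?_⟩
  convert hyU using 1
  funext i
  exact hz i

/-- A function continuous on an open `D ⊆ ℝⁿ` that takes the value `a` at every rational point
of `D` is identically `a` on `D` (the set `D ∩ {F ≠ a}` is open, so if nonempty it has a
rational point). [folklore] -/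
theorem constRig_eqOn_const_of_ratCast {n : ℕ} {D : Set (Fin n → ℝ)} (hD : IsOpen D)
    {F : (Fin n → ℝ) → ℝ} (hF : ContinuousOn F D) (a : ℝ)
    (h : ∀ z : Fin n → ℚ, (fun i => (z i : ℝ)) ∈ D → F (fun i => (z i : ℝ)) = a) :
    ∀ x ∈ D, F x = a := by
  intro x hx
  by_contra hne
  have hO : IsOpen (D ∩ F ⁻¹' {a}ᶜ) := hF.isOpen_inter_preimage hD isOpen_compl_singleton
  obtain ⟨z, hzD, hz⟩ := constRig_exists_ratCast_mem_of_isOpen hO ⟨x, hx, hne⟩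
  exact hz (h z hzD)

/-! ## The stub -/

/-- **Constant-coefficient rigidity** (stub `stub_constRigidity` of line `logderiv-peeling`,
crux `LogPrimitiveNL`): an identity `Σ cᵢ log Wᵢ = G` on an open `ℚ`-semialgebraic `D` with
ALGEBRAIC constants `cᵢ`, continuous positive `ℚ`-semialgebraic `Wᵢ` and continuous
`ℚ`-semialgebraic `G` forces `G ≡ 0` and `c ∈ span_{ℚ̄} {f ∈ ℤᵏ | ∏ Wᵢ^{fᵢ} ≡ 1 on D}`:
write `c = Σ_r β_r f_r` with `β` algebraic and `ℚ`-free and `f_r ∈ ℤᵏ`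
(`constRig_exists_int_structure`); at a RATIONAL point `x` of `D` the values `Wᵢ x`, `G x` are
algebraic (`constRig_isAlgebraic_apply_ratCast`), so `G x = 0` (`constRig_baker_real_eq_zero`)
and, after regrouping `Σᵢ cᵢ log Wᵢ x = Σ_r β_r log ∏ᵢ (Wᵢ x) ^ (f_r i)`, every
`∏ᵢ (Wᵢ x) ^ (f_r i) = 1` (`constRig_baker_real_eq_one_of_linearIndependent`); both conclusions
extend from the dense rational points to all of the open `D` by continuity
(`constRig_eqOn_const_of_ratCast`). -/
theorem stub_constRigidity :
    ∀ (n k : ℕ) (D : Set (Fin n → ℝ)) (c : Fin k → ℝ) (W : Fin k → (Fin n → ℝ) → ℝ)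
      (G : (Fin n → ℝ) → ℝ), IsSemialgebraic ℚ D → IsOpen D → (∀ i, IsAlgebraic ℚ (c i)) →
      (∀ i, IsSemialgebraicFunOn ℚ D (W i)) → (∀ i, ContinuousOn (W i) D) →
      (∀ i, ∀ x ∈ D, 0 < W i x) → IsSemialgebraicFunOn ℚ D G → ContinuousOn G D →
      (∀ x ∈ D, ∑ i, c i * Real.log (W i x) = G x) →
      (∀ x ∈ D, G x = 0) ∧ ∃ (R : ℕ) (f : Fin R → Fin k → ℤ) (β : Fin R → ℝ),
        (∀ r, IsAlgebraic ℚ (β r)) ∧ (∀ r, ∀ x ∈ D, ∏ i, W i x ^ (f r i) = 1) ∧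
        (∀ i, c i = ∑ r, β r * (f r i : ℝ)) := by
  intro n k D c W G _hD hDo hc hW hWc hWpos hG hGc hsum
  classical
  obtain ⟨R, f, β, hβalg, hβli, hcf⟩ := constRig_exists_int_structure c hc
  -- both conclusions at the rational points of `D`
  have key : ∀ z : Fin n → ℚ, (fun i => (z i : ℝ)) ∈ D →
      G (fun i => (z i : ℝ)) = 0 ∧ ∀ r, ∏ i, W i (fun i => (z i : ℝ)) ^ (f r i) = 1 := by
    intro z hz
    set x : Fin n → ℝ := fun i => (z i : ℝ) with hxdef
    have hwalg : ∀ i, IsAlgebraic ℚ (W i x) := fun i =>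
      constRig_isAlgebraic_apply_ratCast n D (W i) z (hW i) hz
    have hGalg : IsAlgebraic ℚ (G x) := constRig_isAlgebraic_apply_ratCast n D G z hG hz
    have hwpos : ∀ i, 0 < W i x := fun i => hWpos i x hz
    have hG0 : G x = 0 :=
      constRig_baker_real_eq_zero (fun i => W i x) c (G x) hwpos hwalg hc hGalg (hsum x hz)
    refine ⟨hG0, ?_⟩
    set u : Fin R → ℝ := fun r => ∏ i, W i x ^ (f r i) with hudef
    have hupos : ∀ r, 0 < u r := fun r => Finset.prod_pos fun i _ => zpow_pos (hwpos i) _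
    have hualg : ∀ r, IsAlgebraic ℚ (u r) := fun r => by
      rw [← mem_algebraicClosure_iff]
      exact prod_mem fun i _ => zpow_mem (mem_algebraicClosure_iff.mpr (hwalg i)) _
    have hlogu : ∀ r, Real.log (u r) = ∑ i, (f r i : ℝ) * Real.log (W i x) := fun r => by
      rw [hudef, Real.log_prod (fun i _ => (zpow_pos (hwpos i) _).ne')]
      exact Finset.sum_congr rfl fun i _ => Real.log_zpow _ _
    have hsum' : ∑ r, β r * Real.log (u r) = 0 := by
      calc ∑ r, β r * Real.log (u r)
            = ∑ r, β r * ∑ i, (f r i : ℝ) * Real.log (W i x) :=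
            Finset.sum_congr rfl fun r _ => by rw [hlogu r]
        _ = ∑ i, (∑ r, β r * (f r i : ℝ)) * Real.log (W i x) := by
            simp_rw [Finset.mul_sum, Finset.sum_mul]
            rw [Finset.sum_comm]
            simp_rw [mul_assoc]
        _ = ∑ i, c i * Real.log (W i x) :=
            Finset.sum_congr rfl fun i _ => by rw [← hcf i]
        _ = 0 := (hsum x hz).trans hG0
    exact constRig_baker_real_eq_one_of_linearIndependent u β hupos hualg hβalg hβli hsum'
  refine ⟨constRig_eqOn_const_of_ratCast hDo hGc 0 fun z hz => (key z hz).1, R, f, β, hβalg,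
    fun r => ?_, hcf⟩
  have hcont : ContinuousOn (fun x => ∏ i, W i x ^ (f r i)) D :=
    continuousOn_finsetProd _ fun i _ => (hWc i).zpow₀ _ fun x hx => Or.inl (hWpos i x hx).ne'
  exact constRig_eqOn_const_of_ratCast hDo hcont 1 fun z hz => (key z hz).2 r

end Summit.KontsevichZagierPeriods.LiouvilleUnfolding.LogPrimitiveNL

end
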